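import Mathlib

set_option linter.dupNamespace false

/-!
# B3♭ — the WNSH lattice law (letter model), monad-4 g23

Typed *specification / arithmetic* file for the cell `hsemireg-monad-4`, generation g23
(unit `hsemireg-monad-4-g23`, crux item `stmt-HodgeConjecture-18881`, decl `BlochSeedDiscOne`).

**Status sentence.** Nothing in this file is proved toward HC / HC_CM / HC_AV / №4 / 26512 /
18881 / H2.  It records, as kernel-checked integer arithmetic, the *letter-lattice law* of the
WNSH-LF window found by monad-4 g22 (memo `B3FLAT-KSTRACE-monad4-g22.md`), i.e. the arithmetic a
class-level design on `X = (E_i × E_i)^4` must satisfy before it can be the Chern character of a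
WNSH-LF carrier.  Designs ≠ displays ≠ sheaves ≠ a SEED.

## The law (pen + machine, memo `B3FLAT-WNSHLATTICE-monad4-g23.md` §1)

Letters `[a,x,y] = a·A_f + x·X_f + y·Y_f` on the factor `S_f = E_i × E_i` (`A² = 2pt`,
`X² = Y² = −2pt`, pairwise products `0`), cells `Z = ⊠_f L(ℓ_f)`, `ch(Z) = ⊗_f (1 + ℓ_f + n_f pt_f)`,
`n_f = a_f² − x_f² − y_f²`.  The ℤ-span of all cell characters is the *letter Chern lattice*
`Λ_ch = ⊗_f ℤ{1, A_f+pt_f, X_f−pt_f, Y_f−pt_f, 2·pt_f}`.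
The WNSH-LF class with integral twist `g` and Weil charge `μ = p + q i` is
`C(g, μ) = 4·exp(g H) + w(μ) + (|μ|²/140)·pt_X`, `w(μ) = μ T + μ̄ T̄`, `T = ∏_f (−X_f + i Y_f)/2`;
the coefficient of the Weil monomial `m_S = ∏_{f∈S} Y_f ∏_{f∉S} X_f` in `w(μ)` is
`c_S = wCoeff8 p q |S| / 8` (table `p, q, −p, −q, p`).  Expanding `C(g, μ)` in the basis of `Λ_ch`
gives: `C(g, μ) ∈ Λ_ch` iff `8 ∣ p`, `8 ∣ q` and, with `p = 8p'`, `q = 8q'`, the system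
`LatticeSystem p' q'` below (one divisibility `2^{|P|} ∣ Σ_i (|P| choose i)·c_{j+i}` per pair
(`P` = factors carrying `pt`, `j` = number of `Y`-factors), the `|P| = 4` line corrected by the
top-degree term `|μ|²/140 = 16(p'²+q'²)/35`).

`closed_form` : `LatticeSystem p' q' ↔ ∃ a b, p' = 28a ∧ q' = 28b ∧ 5 ∣ a²+b²`, i.e.
**`C(g,μ) ∈ Λ_ch ⟺ g ∈ ℤ ∧ μ ∈ 224·ℤ[i] ∧ 5 ∣ N(μ/224)`**; minimal charge `|μ|² = 224²·5 = 250880`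
(`μ = 224(2+i)`), `|μ|²/140 = 1792`.  For an arbitrary bundle (integrality of `ch` on a torus only)
the law is `general_form` : `μ ∈ 56·ℤ[i] ∧ 5 ∣ N(μ/56)` (minimal `|μ|² = 15680`); the letter
alphabet costs exactly a factor `4` (2-adic).  The three designs of record
(`μ/8 = −1728 i, 45888 i, 132480 i`) violate the law already at the prime `7`
(`designs_of_record_not_admissible`).

Machine ×2: `g23/code/wnshlat.py law --box 448` tests lattice membership against the closed form on
63 840 triples `(g,p,q)` with 0 mismatches; `build` produces a canonical virtual letter design of
class `C(2, 448+224i)` (617 cells, ranks 31248/31244) which g22's independent engine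
`ksdoor_g22.py` certifies WNSH-LF (`c₅..c₈ = 0`, `χ(E,E) = 516096`).

Typing rules observed: Mathlib only; no proof placeholders, no type-class instances, no custom
syntax, no banned options.
-/

namespace Summit.HodgeConjecture.HodgeConjecture.Cruxes.BlochSeedDiscOne.WnshLattice

/-! ## 1. The Weil coefficient table and the binomial lattice sums -/

/-- `8 · c_S` for a Weil monomial with `k = |S|` factors equal to `Y`, `μ = p + q i`:
the table `p, q, −p, −q, p` (period 4). -/
def wCoeff8 (p q : ℤ) (k : ℕ) : ℤ :=
  if k % 4 = 0 then p else if k % 4 = 1 then q else if k % 4 = 2 then -p else -q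

/-- The same table after the substitution `p = 8 p'`, `q = 8 q'` (so these are the `c_S` themselves). -/
def wCoeff (p' q' : ℤ) (k : ℕ) : ℤ := wCoeff8 p' q' k

/-- The binomial lattice sum attached to a `Λ_ch`-basis monomial with `n = |P|` point-factors and
`j` factors equal to `Y − pt`:  `Σ_{i=0}^{n} (n choose i) · c_{j+i}`. -/
def latticeSum (p' q' : ℤ) (n j : ℕ) : ℤ :=
  ∑ i ∈ Finset.range (n + 1), (n.choose i : ℤ) * wCoeff p' q' (j + i)

theorem latticeSum_one (p' q' : ℤ) :
    latticeSum p' q' 1 0 = p' + q' ∧ latticeSum p' q' 1 1 = q' - p' ∧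
    latticeSum p' q' 1 2 = -p' - q' ∧ latticeSum p' q' 1 3 = -q' + p' := by
  refine ⟨?_, ?_, ?_, ?_⟩ <;>
    simp [latticeSum, wCoeff, wCoeff8, Finset.sum_range_succ, Nat.choose] <;> ring

theorem latticeSum_two (p' q' : ℤ) :
    latticeSum p' q' 2 0 = 2 * q' ∧ latticeSum p' q' 2 1 = -2 * p' ∧
    latticeSum p' q' 2 2 = -2 * q' := by
  refine ⟨?_, ?_, ?_⟩ <;>
    simp [latticeSum, wCoeff, wCoeff8, Finset.sum_range_succ, Nat.choose]

theorem latticeSum_three (p' q' : ℤ) :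
    latticeSum p' q' 3 0 = -2 * p' + 2 * q' ∧ latticeSum p' q' 3 1 = -2 * p' - 2 * q' := by
  refine ⟨?_, ?_⟩ <;>
    simp [latticeSum, wCoeff, wCoeff8, Finset.sum_range_succ, Nat.choose] <;> ring

theorem latticeSum_four (p' q' : ℤ) : latticeSum p' q' 4 0 = -4 * p' := by
  simp [latticeSum, wCoeff, wCoeff8, Finset.sum_range_succ, Nat.choose]
  ring

/-! ## 2. Level 0: integrality of the Weil coefficients themselves -/

theorem level_zero (p q : ℤ) :
    (∀ k : ℕ, (8 : ℤ) ∣ wCoeff8 p q k) ↔ (8 : ℤ) ∣ p ∧ (8 : ℤ) ∣ q := by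
  constructor
  · intro h
    have h0 := h 0
    have h1 := h 1
    simp [wCoeff8] at h0 h1
    exact ⟨h0, h1⟩
  · rintro ⟨hp, hq⟩ k
    unfold wCoeff8
    split_ifs
    · exact hp
    · exact hq
    · exact (dvd_neg).mpr hp
    · exact (dvd_neg).mpr hq

/-! ## 3. The lattice system in the reduced variables `p', q'` (`μ = 8(p' + q' i)`) -/

/-- The raw membership system `C(g,μ) ∈ Λ_ch` (levels `|P| = 1, 2, 3, 4`), written with the
explicit binomial sums of §1; the last conjunct is the `|P| = 4` line
`16 ∣ −4p' + 16(p'²+q'²)/35` multiplied through by `35` (it contains `35 ∣ 16(p'²+q'²)`,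
i.e. `|μ|²/140 ∈ ℤ`). -/
def LatticeSystem (p' q' : ℤ) : Prop :=
  (2 : ℤ) ∣ p' + q' ∧ (2 : ℤ) ∣ q' - p' ∧ (2 : ℤ) ∣ -p' - q' ∧ (2 : ℤ) ∣ -q' + p' ∧
  (4 : ℤ) ∣ 2 * q' ∧ (4 : ℤ) ∣ -2 * p' ∧ (4 : ℤ) ∣ -2 * q' ∧
  (8 : ℤ) ∣ -2 * p' + 2 * q' ∧ (8 : ℤ) ∣ -2 * p' - 2 * q' ∧
  (560 : ℤ) ∣ -140 * p' + 16 * (p' ^ 2 + q' ^ 2)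

/-- `7` is inert in `ℤ[i]`: `7 ∣ a² + b² → 7 ∣ a ∧ 7 ∣ b`. -/
theorem seven_dvd_of_dvd_sq_add_sq (a b : ℤ) (h : (7 : ℤ) ∣ a ^ 2 + b ^ 2) :
    (7 : ℤ) ∣ a ∧ (7 : ℤ) ∣ b := by
  have key : ∀ x y : ZMod 7, x ^ 2 + y ^ 2 = 0 → x = 0 ∧ y = 0 := by decide
  have h' : ((a : ZMod 7)) ^ 2 + ((b : ZMod 7)) ^ 2 = 0 := by
    have := (ZMod.intCast_zmod_eq_zero_iff_dvd (a ^ 2 + b ^ 2) 7).mpr (by exact_mod_cast h)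
    push_cast at this
    exact this
  obtain ⟨ha, hb⟩ := key _ _ h'
  exact ⟨by exact_mod_cast (ZMod.intCast_zmod_eq_zero_iff_dvd a 7).mp ha,
         by exact_mod_cast (ZMod.intCast_zmod_eq_zero_iff_dvd b 7).mp hb⟩

/-- **The lattice law, closed form.** `μ = 8(p' + q' i)` is letter-admissible iff
`p' = 28a`, `q' = 28b` with `5 ∣ a² + b²`; i.e. `μ ∈ 224·ℤ[i]` and `5 ∣ N(μ/224)`. -/
theorem closed_form (p' q' : ℤ) :
    LatticeSystem p' q' ↔ ∃ a b : ℤ, p' = 28 * a ∧ q' = 28 * b ∧ (5 : ℤ) ∣ a ^ 2 + b ^ 2 := by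
  constructor
  · rintro ⟨-, -, -, -, -, -, -, h8a, h8b, h560⟩
    -- linearise the norm for `omega`
    obtain ⟨N, hN⟩ : ∃ N : ℤ, p' ^ 2 + q' ^ 2 = N := ⟨_, rfl⟩
    rw [hN] at h560
    -- 2-adic part
    have h4p : (4 : ℤ) ∣ p' := by omega
    have h4q : (4 : ℤ) ∣ q' := by omega
    -- 35-part
    have h35 : (35 : ℤ) ∣ N := by omega
    have h7 : (7 : ℤ) ∣ p' ^ 2 + q' ^ 2 := by rw [hN]; exact dvd_trans (by norm_num) h35
    have h5 : (5 : ℤ) ∣ p' ^ 2 + q' ^ 2 := by rw [hN]; exact dvd_trans (by norm_num) h35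
    obtain ⟨h7p, h7q⟩ := seven_dvd_of_dvd_sq_add_sq p' q' h7
    have h28p : (28 : ℤ) ∣ p' := by omega
    have h28q : (28 : ℤ) ∣ q' := by omega
    obtain ⟨a, rfl⟩ := h28p
    obtain ⟨b, rfl⟩ := h28q
    refine ⟨a, b, rfl, rfl, ?_⟩
    have e : (28 * a) ^ 2 + (28 * b) ^ 2 = 784 * (a ^ 2 + b ^ 2) := by ring
    rw [e] at h5
    obtain ⟨M, hM⟩ : ∃ M : ℤ, a ^ 2 + b ^ 2 = M := ⟨_, rfl⟩
    rw [hM] at h5 ⊢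
    omega
  · rintro ⟨a, b, rfl, rfl, ⟨m, hm⟩⟩
    have e : -140 * (28 * a) + 16 * ((28 * a) ^ 2 + (28 * b) ^ 2) = 560 * (-7 * a + 112 * m) := by
      have e' : (28 * a) ^ 2 + (28 * b) ^ 2 = 784 * (a ^ 2 + b ^ 2) := by ring
      rw [e', hm]; ring
    refine ⟨⟨14 * a + 14 * b, by ring⟩, ⟨14 * b - 14 * a, by ring⟩, ⟨-14 * a - 14 * b, by ring⟩,
      ⟨-14 * b + 14 * a, by ring⟩, ⟨14 * b, by ring⟩, ⟨-14 * a, by ring⟩, ⟨-14 * b, by ring⟩,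
      ⟨-7 * a + 7 * b, by ring⟩, ⟨-7 * a - 7 * b, by ring⟩, ?_⟩
    rw [e]
    exact ⟨-7 * a + 112 * m, rfl⟩

/-- The law for an *arbitrary* bundle (only `ch(E) ∈ H^{ev}(X, ℤ)` on the torus is used):
`c_S ∈ ℤ` and `|μ|²/140 ∈ ℤ`, i.e. `8 ∣ p, 8 ∣ q, 140 ∣ p² + q²`; closed form `μ ∈ 56·ℤ[i]`,
`5 ∣ N(μ/56)`.  The letter alphabet (`closed_form`) costs exactly one more factor `4`. -/
theorem general_form (p q : ℤ) :
    ((8 : ℤ) ∣ p ∧ (8 : ℤ) ∣ q ∧ (140 : ℤ) ∣ p ^ 2 + q ^ 2) ↔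
      ∃ a b : ℤ, p = 56 * a ∧ q = 56 * b ∧ (5 : ℤ) ∣ a ^ 2 + b ^ 2 := by
  constructor
  · rintro ⟨⟨p', rfl⟩, ⟨q', rfl⟩, h140⟩
    have e : (8 * p') ^ 2 + (8 * q') ^ 2 = 64 * (p' ^ 2 + q' ^ 2) := by ring
    rw [e] at h140
    obtain ⟨N, hN⟩ : ∃ N : ℤ, p' ^ 2 + q' ^ 2 = N := ⟨_, rfl⟩
    rw [hN] at h140
    have h35 : (35 : ℤ) ∣ N := by omega
    have h7 : (7 : ℤ) ∣ p' ^ 2 + q' ^ 2 := by rw [hN]; exact dvd_trans (by norm_num) h35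
    have h5 : (5 : ℤ) ∣ p' ^ 2 + q' ^ 2 := by rw [hN]; exact dvd_trans (by norm_num) h35
    obtain ⟨⟨a, rfl⟩, ⟨b, rfl⟩⟩ := seven_dvd_of_dvd_sq_add_sq p' q' h7
    refine ⟨a, b, by ring, by ring, ?_⟩
    have e' : (7 * a) ^ 2 + (7 * b) ^ 2 = 49 * (a ^ 2 + b ^ 2) := by ring
    rw [e'] at h5
    obtain ⟨M, hM⟩ : ∃ M : ℤ, a ^ 2 + b ^ 2 = M := ⟨_, rfl⟩
    rw [hM] at h5 ⊢
    omega
  · rintro ⟨a, b, rfl, rfl, ⟨m, hm⟩⟩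
    refine ⟨⟨7 * a, by ring⟩, ⟨7 * b, by ring⟩, ?_⟩
    have e : (56 * a) ^ 2 + (56 * b) ^ 2 = 140 * (112 * m) := by
      have e' : (56 * a) ^ 2 + (56 * b) ^ 2 = 3136 * (a ^ 2 + b ^ 2) := by ring
      rw [e', hm]; ring
    rw [e]
    exact ⟨112 * m, rfl⟩

/-! ## 4. Minimal charge and the designs of record -/

/-- A non-zero admissible reduced charge has norm at least `5`. -/
theorem five_le_norm (a b : ℤ) (h5 : (5 : ℤ) ∣ a ^ 2 + b ^ 2) (hne : a ≠ 0 ∨ b ≠ 0) :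
    5 ≤ a ^ 2 + b ^ 2 := by
  have hpos : 0 < a ^ 2 + b ^ 2 := by
    rcases hne with ha | hb
    · have := pow_pos (abs_pos.mpr ha) 2
      have h2 : |a| ^ 2 = a ^ 2 := sq_abs a
      nlinarith [sq_nonneg b]
    · have := pow_pos (abs_pos.mpr hb) 2
      have h2 : |b| ^ 2 = b ^ 2 := sq_abs b
      nlinarith [sq_nonneg a]
  omega

/-- The minimum is attained at `μ/224 = 2 + i`. -/
theorem norm_five_attained : (5 : ℤ) ∣ (2 : ℤ) ^ 2 + 1 ^ 2 := by norm_num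

/-- **Minimal letter-admissible charge:** `|μ|² ≥ 224² · 5 = 250880` for every non-zero
letter-admissible `μ = 224(a + b i)`; the WNSH top term is then `|μ|²/140 ≥ 1792`. -/
theorem min_letter_charge (a b : ℤ) (h5 : (5 : ℤ) ∣ a ^ 2 + b ^ 2) (hne : a ≠ 0 ∨ b ≠ 0) :
    250880 ≤ (224 * a) ^ 2 + (224 * b) ^ 2 := by
  have := five_le_norm a b h5 hne
  nlinarith

/-- Same for arbitrary bundles: `|μ|² ≥ 56² · 5 = 15680`, top term `≥ 112`. -/
theorem min_general_charge (a b : ℤ) (h5 : (5 : ℤ) ∣ a ^ 2 + b ^ 2) (hne : a ≠ 0 ∨ b ≠ 0) :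
    15680 ≤ (56 * a) ^ 2 + (56 * b) ^ 2 := by
  have := five_le_norm a b h5 hne
  nlinarith

/-- The three designs of record (`ac808a66`: `μ = −13824 i`; `bf2edc09`: `μ = 367104 i`;
`1840bf64`: `μ = 1059840 i`; all with `8 ∣ μ`, reduced charges `μ/8 = −1728 i, 45888 i, 132480 i`)
are **not** letter-admissible — they fail at the prime `7`. (They are not WNSH at all: 76 Lefschetz
monomials off target each, memo §4.) -/
theorem designs_of_record_not_admissible :
    ¬ LatticeSystem 0 (-1728) ∧ ¬ LatticeSystem 0 45888 ∧ ¬ LatticeSystem 0 132480 := by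
  refine ⟨?_, ?_, ?_⟩ <;> (rw [closed_form]; rintro ⟨a, b, ha, hb, -⟩; omega)

/-- … and not even general-bundle admissible (`56 ∤ μ`). -/
theorem designs_of_record_not_general :
    ¬ ((8 : ℤ) ∣ 0 ∧ (8 : ℤ) ∣ (-13824 : ℤ) ∧ (140 : ℤ) ∣ (0 : ℤ) ^ 2 + (-13824) ^ 2) ∧
    ¬ ((8 : ℤ) ∣ 0 ∧ (8 : ℤ) ∣ (367104 : ℤ) ∧ (140 : ℤ) ∣ (0 : ℤ) ^ 2 + 367104 ^ 2) ∧
    ¬ ((8 : ℤ) ∣ 0 ∧ (8 : ℤ) ∣ (1059840 : ℤ) ∧ (140 : ℤ) ∣ (0 : ℤ) ^ 2 + 1059840 ^ 2) := by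
  norm_num

/-! ## 5. Euler-characteristic bookkeeping of a WNSH-LF carrier (`N = |μ|²`) -/

/-- `χ(E,E) = 8·(top term) + ∫ w² = 8·N/140 + 2N = 72N/35` (g22 (W3), re-derived). -/
theorem chiEE_closed (N : ℚ) : 8 * (N / 140) + 2 * N = 72 * N / 35 := by ring

/-- At the minimal letter charge `N = 250880`: `χ(E,E) = 516096` (matches `ksdoor_g22` on the
canonical design) and the top term is `1792`. -/
theorem chiEE_min : (72 : ℚ) * 250880 / 35 = 516096 ∧ (250880 : ℚ) / 140 = 1792 := by norm_num

/-- Ext budget: with Serre duality on the `8`-fold (`eᵢ = e₈₋ᵢ`), `χ = 2e₀ − 2e₁ + 2e₂ − 2e₃ + e₄`,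
and the cycle door's necessary bound `e₂ = ext²(E,E) ≤ h^{3,5}(X) = 3136`, a WNSH-LF carrier of
minimal letter charge needs `e₄ + 2e₀ ≥ 509824 + 2e₁ + 2e₃`. (Curiosity, not a kill.) -/
theorem ext_budget (e0 e1 e2 e3 e4 : ℤ)
    (hchi : 2 * e0 - 2 * e1 + 2 * e2 - 2 * e3 + e4 = 516096) (h2 : e2 ≤ 3136) :
    509824 + 2 * e1 + 2 * e3 ≤ e4 + 2 * e0 := by omega

/-! ## 6. Lefschetz exactness: no two-level design

WNSH forces the `{A, pt}`-profile of the (signed) design measure to be that of `4` copies of the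
letter `g`: `Σ_Z m_Z ∏_{f∈I} a_{Z,f} ∏_{f∈J} n_{Z,f} = 4 g^{|I|+2|J|}` (`+ |μ|²/140` at `J = [4]`).
Already the moments of order `≤ 2` in one factor rule out every design whose `N`-cells share one
`A`-letter `α` and whose `P`-cells share one `A`-letter `α' ≠ α` in that factor. -/

/-- A signed two-atom measure `M_N δ_α − M_P δ_{α'}` with the `0`-th, `1`-st and `2`-nd moments of
`4 δ_g` is trivial: either `(M_N, M_P, g) = (4, 0, α)` or `(0, −4, α')`. -/
theorem two_level_trivial (MN MP α α' g : ℚ) (hne : α ≠ α')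
    (h0 : MN - MP = 4) (h1 : MN * α - MP * α' = 4 * g)
    (h2 : MN * α ^ 2 - MP * α' ^ 2 = 4 * g ^ 2) :
    (MN = 4 ∧ MP = 0 ∧ g = α) ∨ (MN = 0 ∧ MP = -4 ∧ g = α') := by
  have hu : MN * (α - α') = 4 * (g - α') := by linear_combination h1 - α' * h0
  have hu2 : MN * α * (α - α') = 4 * g * (g - α') := by linear_combination h2 - α' * h1
  have key : (α - g) * (MN * (α - α')) = 0 := by linear_combination hu2 - g * hu
  have hαα' : α - α' ≠ 0 := sub_ne_zero.mpr hne
  rcases mul_eq_zero.mp key with h | h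
  · left
    have hg : g = α := by linarith
    subst hg
    have : (MN - 4) * (g - α') = 0 := by linear_combination hu
    rcases mul_eq_zero.mp this with h' | h'
    · refine ⟨by linarith, by linarith, rfl⟩
    · exact absurd h' hαα'
  · right
    rcases mul_eq_zero.mp h with h' | h'
    · refine ⟨h', by linarith, ?_⟩
      subst h'
      linarith
    · exact absurd h' hαα'

end Summit.HodgeConjecture.HodgeConjecture.Cruxes.BlochSeedDiscOne.WnshLattice
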